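import Literature.NumberTheory.DiophantineGeometry.MultiplicativeGroupApproximation
import Literature.NumberTheory.DiophantineGeometry.AbcValuationProduct
import HarnessLib

/-!
# Pasten's subexponential abc bounds, I: splitting `u/v` by the size of the exponents

Topic `NumberTheory/DiophantineGeometry`; namespace `Literature.NumberTheory.DiophantineGeometry.Pasten`.

H. Pasten, *The largest prime factor of `n² + 1` and improvements on subexponential `ABC`*,
Invent. Math. 236 (2024), §§3–5 [cite: Pasten2024, §4]: in every application of the approximation
theorem (Theorem 2.1 there, `Literature.NumberTheory.DiophantineGeometry.Dioph.PastenApproximationBound`)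
a rational number `ξ = u/v` (`u, v` coprime) is written as
`ξ = ξ₀ · ∏_{j ∈ I} p_j^{e_j}`, where `e_p = ν_p(u) − ν_p(v)`, `I` is the set of primes of `uv`
whose exponent exceeds a threshold (`|e_p| > B`) and the *cofactor* `ξ₀ = ∏_{|e_p| ≤ B} p^{e_p}`
collects the small exponents; then `h(ξ₀) ≤ B · log rad(uv)` and `B^{#I} ≤ ∏_{p ∈ I} |e_p| ≤
∏_{p ∣ uvw} ν_p(uvw)` (the quantity bounded by the Shimura-curve input, `exponentProduct`).

This file is the elementary arithmetic of that splitting (no analysis): `expDiff`, `bigPrimes`,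
`cofactor` and their bookkeeping lemmas, followed by the NOTATION shared by the later files of
the series: Pasten's `Θ = K^{#I+1} · max(1, h(ξ₀)) · ∏_{p ∈ I} log p` (`theta`), the exponent
`s(R) = √((log R) log log R)` (`sfun`), `B(R) = exp s(R)` (`bfun`), and the explicit largeness
threshold `L⋆(K, κ) = max(82944, 64K, log κ)` on `log R` (`Lstar`) that replaces the source's
standing convention "the argument of an iterated logarithm is large enough". It is part of the
formalisation of the deduction of Pasten's Theorem 1.4 from his Theorems 2.1 and 2.5 (files
`PastenSubexpDecomposition/Analysis/Generators/Triple/ABC.lean` and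
`Literature/Barriers/ABC/BakerMethodBoundsProofs.lean`); all definitions here are auxiliary
notation for that proof, not new mathematics.

## References

* [Pasten2024] H. Pasten, Invent. Math. 236 (2024), 373–385, doi:10.1007/s00222-024-01244-6,
  arXiv:2312.03566 — §4 (proof of Theorem 1.4 (1)), §5.
-/

noncomputable section

open Finset Real Height

namespace Literature.NumberTheory.DiophantineGeometry.Pasten

variable {u v : ℕ}

/-! ### The exponent of `p` in `u/v` -/

/-- The exponent `e_p = ν_p(u) − ν_p(v) ∈ ℤ` of the prime `p` in the rational number `u/v`
(for coprime `u, v` one of the two terms vanishes). [cite: Pasten2024, §4] -/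
def expDiff (u v p : ℕ) : ℤ :=
  (u.factorization p : ℤ) - (v.factorization p : ℤ)

/-- Unfolding lemma for `expDiff`. [folklore] -/
theorem expDiff_def (u v p : ℕ) :
    expDiff u v p = (u.factorization p : ℤ) - (v.factorization p : ℤ) :=
  rfl

/-- For coprime `u, v`, a prime occurring in `u` does not occur in `v`. [folklore] -/
theorem factorization_eq_zero_of_coprime (huv : u.Coprime v) {p : ℕ}
    (hp : u.factorization p ≠ 0) : v.factorization p = 0 := by
  apply Nat.factorization_eq_zero_of_not_dvd
  intro hpv
  have hpu : p ∣ u := Nat.dvd_of_factorization_pos hp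
  have h1 : p ∣ Nat.gcd u v := Nat.dvd_gcd hpu hpv
  rw [huv.gcd_eq_one, Nat.dvd_one] at h1
  subst h1
  simp at hp

/-- `e_p = ν_p(u)` for the primes of `u`. [folklore] -/
theorem expDiff_of_left (huv : u.Coprime v) {p : ℕ} (hp : u.factorization p ≠ 0) :
    expDiff u v p = u.factorization p := by
  rw [expDiff, factorization_eq_zero_of_coprime huv hp]; simp

/-- `e_p = -ν_p(v)` for the primes of `v`. [folklore] -/
theorem expDiff_of_right (huv : u.Coprime v) {p : ℕ} (hp : v.factorization p ≠ 0) :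
    expDiff u v p = -(v.factorization p : ℤ) := by
  rw [expDiff, factorization_eq_zero_of_coprime huv.symm hp]; simp

/-- `|e_p| = ν_p(uv)` for coprime `u, v`. [folklore] -/
theorem natAbs_expDiff (hu : u ≠ 0) (hv : v ≠ 0) (huv : u.Coprime v) (p : ℕ) :
    (expDiff u v p).natAbs = (u * v).factorization p := by
  rw [Nat.factorization_mul hu hv, Finsupp.add_apply]
  by_cases h : u.factorization p = 0
  · rw [expDiff, h]; simp
  · rw [expDiff_of_left huv h, factorization_eq_zero_of_coprime huv h]; simp

/-- `u/v = ∏_{p ∣ uv} p^{e_p}` for coprime positive `u, v`. [folklore] -/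
theorem cast_div_eq_prod_zpow (hu : u ≠ 0) (hv : v ≠ 0) (huv : u.Coprime v) :
    (u : ℚ) / v = ∏ p ∈ (u * v).primeFactors, (p : ℚ) ^ expDiff u v p := by
  rw [Nat.primeFactors_mul hu hv, Finset.prod_union huv.disjoint_primeFactors]
  have h1 : ∏ p ∈ u.primeFactors, (p : ℚ) ^ expDiff u v p = u := by
    conv_rhs => rw [Nat.prod_primeFactors_pow_factorization hu]
    push_cast
    refine Finset.prod_congr rfl fun p hp => ?_
    have hp' : u.factorization p ≠ 0 := by
      rwa [← Finsupp.mem_support_iff, Nat.support_factorization]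
    rw [expDiff_of_left huv hp', zpow_natCast]
  have h2 : ∏ p ∈ v.primeFactors, (p : ℚ) ^ expDiff u v p = (v : ℚ)⁻¹ := by
    conv_rhs => rw [Nat.prod_primeFactors_pow_factorization hv]
    push_cast
    rw [← Finset.prod_inv_distrib]
    refine Finset.prod_congr rfl fun p hp => ?_
    have hp' : v.factorization p ≠ 0 := by
      rwa [← Finsupp.mem_support_iff, Nat.support_factorization]
    rw [expDiff_of_right huv hp', zpow_neg, zpow_natCast]
  rw [h1, h2, div_eq_mul_inv]

/-! ### Big primes and the cofactor -/

/-- The primes of `uv` whose exponent in `u/v` exceeds the threshold `N` in absolute value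
(Pasten's index set `I`). [cite: Pasten2024, §4] -/
def bigPrimes (u v N : ℕ) : Finset ℕ :=
  (u * v).primeFactors.filter fun p => N < (expDiff u v p).natAbs

/-- The cofactor `ξ₀ = ∏_{p ∣ uv, |e_p| ≤ N} p^{e_p}` collecting the primes with small exponent
(Pasten's `ξ₀`). [cite: Pasten2024, §4] -/
def cofactor (u v N : ℕ) : ℚ :=
  ∏ p ∈ (u * v).primeFactors.filter (fun p => ¬N < (expDiff u v p).natAbs),
    (p : ℚ) ^ expDiff u v p

/-- Unfolding lemma for `bigPrimes`. [folklore] -/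
theorem mem_bigPrimes {N p : ℕ} :
    p ∈ bigPrimes u v N ↔ p ∈ (u * v).primeFactors ∧ N < (expDiff u v p).natAbs :=
  Finset.mem_filter

/-- Unfolding lemma for `cofactor`. [folklore] -/
theorem cofactor_def (u v N : ℕ) : cofactor u v N =
    ∏ p ∈ (u * v).primeFactors.filter (fun p => ¬N < (expDiff u v p).natAbs),
      (p : ℚ) ^ expDiff u v p :=
  rfl

/-- Big primes are primes dividing `uv`. [folklore] -/
theorem prime_of_mem_bigPrimes {N p : ℕ} (hp : p ∈ bigPrimes u v N) : p.Prime :=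
  Nat.prime_of_mem_primeFactors (mem_bigPrimes.mp hp).1

/-- `bigPrimes u v N ⊆ (uv).primeFactors`. [folklore] -/
theorem bigPrimes_subset (u v N : ℕ) : bigPrimes u v N ⊆ (u * v).primeFactors :=
  Finset.filter_subset _ _

/-- The splitting `u/v = ξ₀ · ∏_{p ∈ I} p^{e_p}`. [cite: Pasten2024, §4] -/
theorem cast_div_eq_cofactor_mul_prod (hu : u ≠ 0) (hv : v ≠ 0) (huv : u.Coprime v) (N : ℕ) :
    (u : ℚ) / v = cofactor u v N * ∏ p ∈ bigPrimes u v N, (p : ℚ) ^ expDiff u v p := by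
  rw [cast_div_eq_prod_zpow hu hv huv, cofactor, bigPrimes,
    ← Finset.prod_filter_mul_prod_filter_not (u * v).primeFactors
      (fun p => N < (expDiff u v p).natAbs)]
  exact mul_comm _ _

/-- The cofactor is positive. [folklore] -/
theorem cofactor_pos (u v N : ℕ) : 0 < cofactor u v N := by
  rw [cofactor_def]
  refine Finset.prod_pos fun p hp => ?_
  have hp' : p.Prime := Nat.prime_of_mem_primeFactors (Finset.mem_filter.mp hp).1
  exact zpow_pos (by exact_mod_cast hp'.pos) _

/-- Height of the cofactor: `h(ξ₀) ≤ N · log rad(uv)` (`rad(uv) = ∏_{p ∣ uv} p`).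
[cite: Pasten2024, §4] -/
theorem logHeight₁_cofactor_le (u v N : ℕ) :
    logHeight₁ (cofactor u v N) ≤ N * Real.log (∏ p ∈ (u * v).primeFactors, (p : ℝ)) := by
  have hlog0 : ∀ p ∈ (u * v).primeFactors, 0 ≤ Real.log p := fun p hp =>
    Real.log_nonneg (by exact_mod_cast (Nat.prime_of_mem_primeFactors hp).one_lt.le)
  rw [cofactor_def]
  calc logHeight₁ (∏ p ∈ (u * v).primeFactors.filter (fun p => ¬N < (expDiff u v p).natAbs),
          (p : ℚ) ^ expDiff u v p)
      ≤ ∑ p ∈ (u * v).primeFactors.filter (fun p => ¬N < (expDiff u v p).natAbs),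
          logHeight₁ ((p : ℚ) ^ expDiff u v p) := logHeight₁_prod_le _ _
    _ = ∑ p ∈ (u * v).primeFactors.filter (fun p => ¬N < (expDiff u v p).natAbs),
          ((expDiff u v p).natAbs : ℝ) * Real.log p := by
        refine Finset.sum_congr rfl fun p hp => ?_
        have hp' : p.Prime := Nat.prime_of_mem_primeFactors (Finset.mem_filter.mp hp).1
        haveI : NeZero p := ⟨hp'.ne_zero⟩
        rw [logHeight₁_zpow, Rat.logHeight₁_natCast]
    _ ≤ ∑ p ∈ (u * v).primeFactors.filter (fun p => ¬N < (expDiff u v p).natAbs),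
          (N : ℝ) * Real.log p := by
        refine Finset.sum_le_sum fun p hp => ?_
        obtain ⟨hpS, hpN⟩ := Finset.mem_filter.mp hp
        exact mul_le_mul_of_nonneg_right (by exact_mod_cast not_lt.mp hpN) (hlog0 p hpS)
    _ ≤ ∑ p ∈ (u * v).primeFactors, (N : ℝ) * Real.log p :=
        Finset.sum_le_sum_of_subset_of_nonneg (Finset.filter_subset _ _) fun p hpS _ =>
          mul_nonneg (Nat.cast_nonneg _) (hlog0 p hpS)
    _ = N * Real.log (∏ p ∈ (u * v).primeFactors, (p : ℝ)) := by
        rw [← Finset.mul_sum, Real.log_prod]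
        intro p hp
        exact_mod_cast (Nat.prime_of_mem_primeFactors hp).ne_zero

/-- If no prime is big, the cofactor is `u/v` itself, hence `≠ 1` as soon as `uv > 1`.
[folklore] -/
theorem cofactor_ne_one (hu : u ≠ 0) (hv : v ≠ 0) (huv : u.Coprime v) {N : ℕ}
    (hT : bigPrimes u v N = ∅) (h1 : 1 < u * v) : cofactor u v N ≠ 1 := by
  intro h
  have key := cast_div_eq_cofactor_mul_prod hu hv huv N
  rw [hT, Finset.prod_empty, mul_one, h] at key
  have hv' : (v : ℚ) ≠ 0 := by exact_mod_cast hv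
  rw [div_eq_one_iff_eq hv'] at key
  have huv' : u = v := by exact_mod_cast key
  subst huv'
  have hu1 : u = 1 := by simpa using huv
  subst hu1
  simp at h1

/-- On the big primes, `N < |e_p| = ν_p(uv)`. [folklore] -/
theorem lt_factorization_of_mem_bigPrimes (hu : u ≠ 0) (hv : v ≠ 0) (huv : u.Coprime v)
    {N p : ℕ} (hp : p ∈ bigPrimes u v N) : N < (u * v).factorization p := by
  rw [← natAbs_expDiff hu hv huv]; exact (mem_bigPrimes.mp hp).2

/-- `(N+1)^{#I} ≤ ∏_{p ∈ I} ν_p(uv)`. [cite: Pasten2024, §4] -/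
theorem pow_card_bigPrimes_le (hu : u ≠ 0) (hv : v ≠ 0) (huv : u.Coprime v) (N : ℕ) :
    (N + 1) ^ (bigPrimes u v N).card ≤ ∏ p ∈ bigPrimes u v N, (u * v).factorization p := by
  rw [← Finset.prod_const]
  exact Finset.prod_le_prod (fun _ _ => Nat.zero_le _) fun p hp =>
    Nat.succ_le_of_lt (lt_factorization_of_mem_bigPrimes hu hv huv hp)

/-- `∏_{p ∈ I} ν_p(uv) ≤ ∏_{p ∣ uvw} ν_p(uvw)` for `w` coprime to `uv`. [cite: Pasten2024, §4] -/
theorem prod_bigPrimes_le_exponentProduct (hu : u ≠ 0) (hv : v ≠ 0) {w : ℕ} (hw : w ≠ 0)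
    (hcop : (u * v).Coprime w) (N : ℕ) :
    ∏ p ∈ bigPrimes u v N, (u * v).factorization p ≤ exponentProduct (u * v * w) := by
  rw [exponentProduct_def]
  have huv0 : u * v ≠ 0 := mul_ne_zero hu hv
  have hsub : bigPrimes u v N ⊆ (u * v * w).primeFactors := by
    intro p hp
    rw [Nat.primeFactors_mul huv0 hw]
    exact Finset.mem_union_left _ (bigPrimes_subset u v N hp)
  calc ∏ p ∈ bigPrimes u v N, (u * v).factorization p
      = ∏ p ∈ bigPrimes u v N, (u * v * w).factorization p := by
        refine Finset.prod_congr rfl fun p hp => ?_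
        have hpS := bigPrimes_subset u v N hp
        rw [Nat.factorization_mul huv0 hw, Finsupp.add_apply]
        have hne : (u * v).factorization p ≠ 0 := by
          rwa [← Finsupp.mem_support_iff, Nat.support_factorization]
        rw [factorization_eq_zero_of_coprime hcop hne, add_zero]
    _ ≤ ∏ p ∈ (u * v * w).primeFactors, (u * v * w).factorization p := by
        apply Nat.le_of_dvd
        · refine Finset.prod_pos fun p hp => Nat.pos_of_ne_zero ?_
          rwa [← Finsupp.mem_support_iff, Nat.support_factorization]
        · exact Finset.prod_dvd_prod_of_subset _ _ _ hsub

/-- `(N+1)^{#I} ≤ exponentProduct(uvw)`: the number of big primes is controlled by the product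
of the exponents of `uvw`. [cite: Pasten2024, §4] -/
theorem pow_card_bigPrimes_le_exponentProduct (hu : u ≠ 0) (hv : v ≠ 0) (huv : u.Coprime v)
    {w : ℕ} (hw : w ≠ 0) (hcop : (u * v).Coprime w) (N : ℕ) :
    (N + 1) ^ (bigPrimes u v N).card ≤ exponentProduct (u * v * w) :=
  (pow_card_bigPrimes_le hu hv huv N).trans (prod_bigPrimes_le_exponentProduct hu hv hw hcop N)

/-- Every big prime divides `rad(uvw)`, hence is at most `rad(uvw)`. [folklore] -/
theorem le_radical_of_mem_bigPrimes (hu : u ≠ 0) (hv : v ≠ 0) {w : ℕ} (hw : w ≠ 0) {N p : ℕ}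
    (hp : p ∈ bigPrimes u v N) : p ≤ UniqueFactorizationMonoid.radical (u * v * w) := by
  have hpS := bigPrimes_subset u v N hp
  have hmem : p ∈ (UniqueFactorizationMonoid.radical (u * v * w)).primeFactors := by
    rw [Nat.primeFactors_radical, Nat.primeFactors_mul (mul_ne_zero hu hv) hw]
    exact Finset.mem_union_left _ hpS
  exact Nat.le_of_dvd (Nat.radical_pos _) (Nat.dvd_of_mem_primeFactors hmem)

/-- `∏_{p ∣ uv} p = rad(uv) ≤ rad(uvw)` (as real numbers). [folklore] -/
theorem prod_primeFactors_le_radical (hu : u ≠ 0) (hv : v ≠ 0) {w : ℕ} (hw : w ≠ 0) :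
    (∏ p ∈ (u * v).primeFactors, (p : ℝ)) ≤
      (UniqueFactorizationMonoid.radical (u * v * w) : ℕ) := by
  have h1 : (∏ p ∈ (u * v).primeFactors, (p : ℝ)) =
      ((UniqueFactorizationMonoid.radical (u * v) : ℕ) : ℝ) := by
    rw [Nat.radical_eq_prod_primeFactors]; push_cast; rfl
  rw [h1]
  exact_mod_cast Nat.le_of_dvd (Nat.radical_pos _)
    (UniqueFactorizationMonoid.radical_dvd_radical (Dvd.intro w rfl)
      (mul_ne_zero (mul_ne_zero hu hv) hw))

/-- `∏_{p ∈ I} log p ≤ (log rad(uvw))^{#I}`. [cite: Pasten2024, §4] -/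
theorem prod_log_bigPrimes_le (hu : u ≠ 0) (hv : v ≠ 0) {w : ℕ} (hw : w ≠ 0) (N : ℕ) :
    ∏ p ∈ bigPrimes u v N, Real.log p ≤
      Real.log (UniqueFactorizationMonoid.radical (u * v * w) : ℕ) ^ (bigPrimes u v N).card := by
  rw [← Finset.prod_const]
  refine Finset.prod_le_prod (fun p hp => ?_) fun p hp => ?_
  · exact Real.log_nonneg (by exact_mod_cast (prime_of_mem_bigPrimes hp).one_lt.le)
  · exact Real.log_le_log (by exact_mod_cast (prime_of_mem_bigPrimes hp).pos)
      (by exact_mod_cast le_radical_of_mem_bigPrimes hu hv hw hp)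

/-- `0 ≤ ∏_{p ∈ I} log p`. [folklore] -/
theorem prod_log_bigPrimes_nonneg (u v N : ℕ) : 0 ≤ ∏ p ∈ bigPrimes u v N, Real.log p :=
  Finset.prod_nonneg fun p hp =>
    Real.log_nonneg (by exact_mod_cast (prime_of_mem_bigPrimes hp).one_lt.le)

/-! ### Notation shared by the later files: `Θ`, `s(R)`, `B(R)`, `L⋆` -/

/-- Pasten's `Θ` for the splitting of `u/v` at threshold `N`:
`Θ = K^{#I+1} · max(1, h(ξ₀)) · ∏_{p ∈ I} log p`. [cite: Pasten2024, §4] -/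
def theta (K : ℝ) (u v N : ℕ) : ℝ :=
  K ^ ((bigPrimes u v N).card + 1) *
    (max 1 (logHeight₁ (cofactor u v N)) * ∏ p ∈ bigPrimes u v N, Real.log p)

/-- Unfolding lemma for `theta`. [folklore] -/
theorem theta_def (K : ℝ) (u v N : ℕ) : theta K u v N =
    K ^ ((bigPrimes u v N).card + 1) *
      (max 1 (logHeight₁ (cofactor u v N)) * ∏ p ∈ bigPrimes u v N, Real.log p) :=
  rfl

/-- Pasten's exponent `s(R) = √((log R) · log log R)`, so that `B = exp s(R)`.
[cite: Pasten2024, §4] -/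
def sfun (R : ℝ) : ℝ :=
  Real.sqrt (Real.log R * Real.log (Real.log R))

/-- Pasten's `B = B(R) = exp(√((log R) log₂ R))`. [cite: Pasten2024, §4] -/
def bfun (R : ℝ) : ℝ :=
  Real.exp (sfun R)

/-- Unfolding lemma for `sfun`. [folklore] -/
theorem sfun_def (R : ℝ) : sfun R = Real.sqrt (Real.log R * Real.log (Real.log R)) :=
  rfl

/-- Unfolding lemma for `bfun`. [folklore] -/
theorem bfun_def (R : ℝ) : bfun R = Real.exp (sfun R) :=
  rfl

/-- `B > 0`. [folklore] -/
theorem bfun_pos (R : ℝ) : 0 < bfun R :=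
  Real.exp_pos _

/-- `B^k = exp(k · s)`. [folklore] -/
theorem bfun_pow (R : ℝ) (k : ℕ) : bfun R ^ k = Real.exp (k * sfun R) := by
  rw [bfun_def, ← Real.exp_nat_mul]

/-- The explicit largeness threshold on `L = log R` ("for `R` large enough" in the source), in
terms of the absolute constants `K ≥ 1` (Theorem 2.1) and `κ ≥ 1` (Theorem 2.5 with `ε = 1/3`):
`L⋆ = max(82944, 64K, log κ)`. [folklore] -/
def Lstar (K κ : ℝ) : ℝ :=
  max (max 82944 (64 * K)) (Real.log κ)

/-- Unfolding lemma for `Lstar`. [folklore] -/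
theorem Lstar_def (K κ : ℝ) : Lstar K κ = max (max 82944 (64 * K)) (Real.log κ) :=
  rfl

end Literature.NumberTheory.DiophantineGeometry.Pasten

end
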